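import Summits.ValiantsHypothesis.ValiantsHypothesis.Theorems.RigidityForcesSymmetryRankRigidMinimalReprLaplaceDefs

/-!
# Sketch for the crux idea `twin-span-depth` on `LaplaceOptimalFive` (stmt-ValiantsHypothesis-24813) — val-idea-19 g3

HONEST FRAMING.  Nothing here proves `LaplaceOptimalFive` / `LaplaceOptimal 5` (stmt-24813 stays OPEN); the crux
`RankRigidMinimalRepr` (18034) does not move; `LaplaceOptimalFourFive` (27319) is REFUTED and unused; VP ≠ VNP is NOT proved.
Companion fact (kernel-certified in `Cruxes/LaplaceOptimalFive/LaplaceSixExact.lean`): `¬ LaplaceOptimal 6` — the even rungs are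
false exactly, so every lemma below that matters is stated at `d = 5` or carries the parity of `d` explicitly.

Contents: the MIRROR IDENTITY of a split-rank-one term and its corollary «a fat honest part emits junk at both mirror contents»
(proved); the collision depth; the two typed cruxes of the idea — K1 `odd_surfacing_five` (cheap ⇒ some term emits depth-1
cut-junk; the parity-sensitive half, FALSE at `d = 6`) and K2 `depth_one_uncancellable_five` (depth-1 cut-junk cannot be cancelled
below weight 120; the twin-span half) — as sorried stubs, and the kernel-checked assembly `laplaceOptimal_five_of_K1_K2`.
-/

set_option autoImplicit false
set_option linter.dupNamespace false

namespace Summit.ValiantsHypothesis.ValiantsHypothesis.Cruxes.LaplaceOptimalFive.TwinSpanDepth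

open Finset

open Summit.ValiantsHypothesis.ValiantsHypothesis.Theorems.RigidityForcesSymmetryRankRigidMinimalRepr (LaplaceOptimal)

/-- Glue a short word `x` (read on the slots of `S`) and a long word `y` (read off `S`). -/
def glue {d : ℕ} (S : Finset (Fin d)) (x y : Fin d → Fin d) : Fin d → Fin d :=
  fun i => if i ∈ S then x i else y i

@[simp] theorem glue_of_mem {d : ℕ} (S : Finset (Fin d)) (x y : Fin d → Fin d) {i : Fin d} (h : i ∈ S) :
    glue S x y i = x i := by simp [glue, h]

@[simp] theorem glue_of_not_mem {d : ℕ} (S : Finset (Fin d)) (x y : Fin d → Fin d) {i : Fin d} (h : i ∉ S) :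
    glue S x y i = y i := by simp [glue, h]

/-- **MIRROR IDENTITY.**  For a split-rank-one term `u ⊗ w` across `S` (locality as in `LaplaceOptimal`) and any two short words
`x, x'` and long words `y, y'`, the `2 × 2` minor vanishes:
`T(x|y) · T(x'|y') = T(x|y') · T(x'|y)` where `T(x|y) = u(glue x y) · w(glue x y)`.
When `(x|y')` and `(x'|y)` are HONEST cells (permutations, letter blocks `A = im x`, `A' = im x'`) the left side is the product
of the term's values at the two MIRROR JUNK contents `A ⊎ A'ᶜ` and `A' ⊎ Aᶜ`. -/
theorem mirror_identity {d : ℕ} (S : Finset (Fin d)) (u w : (Fin d → Fin d) → ℂ)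
    (hu : ∀ v v' : Fin d → Fin d, (∀ i ∈ S, v i = v' i) → u v = u v')
    (hw : ∀ v v' : Fin d → Fin d, (∀ i, i ∉ S → v i = v' i) → w v = w v')
    (x x' y y' : Fin d → Fin d) :
    (u (glue S x y) * w (glue S x y)) * (u (glue S x' y') * w (glue S x' y'))
      = (u (glue S x y') * w (glue S x y')) * (u (glue S x' y) * w (glue S x' y)) := by
  have h1 : u (glue S x y) = u (glue S x y') := hu _ _ (fun i hi => by simp [hi])
  have h2 : u (glue S x' y') = u (glue S x' y) := hu _ _ (fun i hi => by simp [hi])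
  have h3 : w (glue S x y) = w (glue S x' y) := hw _ _ (fun i hi => by simp [hi])
  have h4 : w (glue S x' y') = w (glue S x y') := hw _ _ (fun i hi => by simp [hi])
  rw [h1, h2, h3, h4]; ring

/-- **A fat honest part emits junk at BOTH mirror contents.**  If the term is non-zero at the cells `(x|y')` and `(x'|y)` then it is
non-zero at `(x|y)` and at `(x'|y')`.  (Used with `(x|y')`, `(x'|y)` honest cells in two different letter blocks: then `(x|y)`,
`(x'|y')` are non-injective words — junk that an honest decomposition must cancel on both sides, a border family on one.) -/
theorem fat_emits_junk {d : ℕ} (S : Finset (Fin d)) (u w : (Fin d → Fin d) → ℂ)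
    (hu : ∀ v v' : Fin d → Fin d, (∀ i ∈ S, v i = v' i) → u v = u v')
    (hw : ∀ v v' : Fin d → Fin d, (∀ i, i ∉ S → v i = v' i) → w v = w v')
    (x x' y y' : Fin d → Fin d)
    (h1 : u (glue S x y') * w (glue S x y') ≠ 0) (h2 : u (glue S x' y) * w (glue S x' y) ≠ 0) :
    u (glue S x y) * w (glue S x y) ≠ 0 ∧ u (glue S x' y') * w (glue S x' y') ≠ 0 := by
  have hm := mirror_identity S u w hu hw x x' y y'
  have hne : (u (glue S x y) * w (glue S x y)) * (u (glue S x' y') * w (glue S x' y')) ≠ 0 := by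
    rw [hm]; exact mul_ne_zero h1 h2
  exact ⟨left_ne_zero_of_mul hne, right_ne_zero_of_mul hne⟩

/-- COLLISION DEPTH of a word: the number of missing letters (`= d −` number of distinct letters used). Permutations have depth `0`;
the mirror junk of two letter blocks `A ≠ A'` of a pair term at `d = 5` has depth `|A ∖ A'| ∈ {1, 2}`; the junk of the cheap honest
`d = 6` decomposition (`LaplaceSixExact`) has depth `3` only. -/
def collisionDepth {d : ℕ} (v : Fin d → Fin d) : ℕ := d - (Finset.univ.image v).card

/-- Depth dichotomy for letter PAIRS at `d = 5` (kernel `decide`): two distinct `2`-subsets `A, A'` of `Fin 5` give mirror content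
`A ⊎ A'ᶜ` with `5 − |A ∪ A'ᶜ| = |A ∖ A'|` missing letters, and this depth is `1` (the blocks share a letter) or `2` (disjoint blocks);
complementary blocks (`A' = Aᶜ`, depth `|A|`, the even-`d` dive) do not exist since `|Aᶜ| = 3`. -/
theorem pair_depth_dichotomy :
    ∀ A A' : Finset (Fin 5), A.card = 2 → A'.card = 2 → A ≠ A' →
      (Finset.univ \ (A ∪ A'ᶜ)).card = (A \ A').card ∧ ((A \ A').card = 1 ∨ (A \ A').card = 2) ∧
      ((A \ A').card = 2 ↔ Disjoint A A') ∧ A' ≠ Aᶜ := by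
  decide

/-- **K1 — ODD SURFACING (crux of the idea, rank 2; the parity-sensitive half).**  Every split decomposition of `P₅` of Laplace
weight `< 120` has a term with DEPTH-ONE CUT-JUNK: a word `v` using exactly four letters, injective on `S_t` and on `S_tᶜ` (so the
one collision is cut by the split), at which the term is non-zero.  FALSE at `d = 6` (the weight-648 decomposition has junk of depth
3 only) — this is where a proof must see that `5` is odd.  Evidence: all 510 non-Laplace unit tilings of `S₅` by ten Young blocks put
two letter blocks sharing a letter on one split (enumeration, val-idea-19 g3). -/
theorem odd_surfacing_five (N : ℕ) (T : Finset (Fin N)) (S : Fin N → Finset (Fin 5))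
    (u w : Fin N → (Fin 5 → Fin 5) → ℂ)
    (hu : ∀ t, ∀ v v' : Fin 5 → Fin 5, (∀ i ∈ S t, v i = v' i) → u t v = u t v')
    (hw : ∀ t, ∀ v v' : Fin 5 → Fin 5, (∀ i, i ∉ S t → v i = v' i) → w t v = w t v')
    (hid : ∀ v : Fin 5 → Fin 5, (∑ t ∈ T, u t v * w t v) = if Function.Injective v then 1 else 0)
    (hcheap : (∑ t ∈ T, (S t).card.factorial * (5 - (S t).card).factorial) < Nat.factorial 5) :
    ∃ t ∈ T, ∃ v : Fin 5 → Fin 5, (Finset.univ.image v).card = 4 ∧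
      Set.InjOn v (↑(S t) : Set (Fin 5)) ∧ Set.InjOn v ((↑(S t) : Set (Fin 5))ᶜ) ∧ u t v * w t v ≠ 0 := by
  sorry

/-- **K2 — DEPTH-ONE JUNK IS UNCANCELLABLE BELOW 120 (crux of the idea, rank 3; the twin-span half).**  A split decomposition of
`P₅` in which some term carries depth-one cut-junk has Laplace weight `≥ 120`.  Mechanism: at a one-collision word with twins in
slots `{p,q}` and letter `a`, the only free cleaning capacity is `u_t(a,a)` of the terms ON the split `{p,q}` and the
`w_t(a,a,·)` of the terms on splits INSIDE `{p,q}ᶜ` — `m_{pq} + 4·n_{pq}` numbers against `24` equations per letter, total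
`9 + 108 = 117 < 240` for nine pair terms — so the cut-junk forcing (pinned to the honest parts by `mirror_identity`) must satisfy
rank-EQUALITY (span) conditions, which fail in every border limit.  Why it might fail: depth-one cross-cancellation between fat
terms IS possible in the rectangular pattern `P₄,₅` (weight-8 identities, p623338). -/
theorem depth_one_uncancellable_five (N : ℕ) (T : Finset (Fin N)) (S : Fin N → Finset (Fin 5))
    (u w : Fin N → (Fin 5 → Fin 5) → ℂ)
    (hu : ∀ t, ∀ v v' : Fin 5 → Fin 5, (∀ i ∈ S t, v i = v' i) → u t v = u t v')
    (hw : ∀ t, ∀ v v' : Fin 5 → Fin 5, (∀ i, i ∉ S t → v i = v' i) → w t v = w t v')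
    (hid : ∀ v : Fin 5 → Fin 5, (∑ t ∈ T, u t v * w t v) = if Function.Injective v then 1 else 0)
    (hsurf : ∃ t ∈ T, ∃ v : Fin 5 → Fin 5, (Finset.univ.image v).card = 4 ∧
      Set.InjOn v (↑(S t) : Set (Fin 5)) ∧ Set.InjOn v ((↑(S t) : Set (Fin 5))ᶜ) ∧ u t v * w t v ≠ 0) :
    Nat.factorial 5 ≤ ∑ t ∈ T, (S t).card.factorial * (5 - (S t).card).factorial := by
  sorry

/-- ASSEMBLY (kernel-checked modulo the two stubs): K1 ∧ K2 ⟹ `LaplaceOptimal 5` (= `LaplaceOptimalFive`, `laplaceOptimalFive_iff`). -/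
theorem laplaceOptimal_five_of_K1_K2 : LaplaceOptimal 5 := by
  intro N T S u w hu hw hid
  by_contra hlt
  exact hlt (depth_one_uncancellable_five N T S u w hu hw hid (odd_surfacing_five N T S u w hu hw hid (not_le.mp hlt)))

end Summit.ValiantsHypothesis.ValiantsHypothesis.Cruxes.LaplaceOptimalFive.TwinSpanDepth
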